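import Summits.QuantumFields.YangMills.Theorems.BalabanUVNodesN15KingModelSandwichRate
import Summits.QuantumFields.YangMills.Theorems.BalabanUVNodesN15KingModelPerturbedLimit

/-!
# Route «BalabanUVNodes» (K4 «SpineRates»), node N15 = NE2 — THE KING-MODEL RUNG, part 7b: KING'S DRESSED COVARIANCE TO FIRST ORDER IN THE BACKGROUND —
# the η-rates of the first-order term `C₀^{(j)}E_jC₀^{(j)}` and of the background-dependent part `C_E^{(j)} − C₀^{(j)}` BY NAME, LINEAR IN THE BACKGROUND
# SIZE, same `δ₄₅`, same `L⁻¹`; the limit form; and NE2's typed `EtaRateIneqUnit` for the background-dependent part of the dressed unit kernel with a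
# constant LINEAR in the regularity size

Cell `pub-ymgap`, Track A (D-0062), seat `pub-ymgap-dag-n15-d` (R134 seat, strategy s3 «King 1986 Lemma 4.5 (4.38) as the scalar kernel», gen 5;
dag-lead FAN-OUT v1.2 §N15 s3 «KING-MODEL RUNG»).  `bears_on: R4∕N15`; `--supports` the K3′ item `SpineGivenEndpointR12` (stmt-QuantumFields-19908,
rev 15).  COUNT-NEUTRAL; definition lane (one constant and one site kernel are data; every theorem is by-name plumbing of LANDED kernel theorems: part 7a
`…KingModelSandwichRate`, parts 3∕6a∕6b∕6c).

WHY THIS FILE.  Part 6b fired the unit-layer socket with the background block LIVE (`ne2PlusUnit_kingE`: constants UNIFORM over the regular backgrounds)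
and proved background-Lipschitz continuity level by level (`kingCovE_lipschitz`); part 7a proved the generic JOINT estimate.  THIS FILE reads it on King's
tower BY NAME: for every background `E` that is local at King's Combes–Thomas rate `κ′` with size `c_E ≤ c̄` and has the two-spacing rate `ε_E·L^{−2j}`,
`ε_E ≤ c̄`,
 * **`kingFirstOrder_rate`** — the FIRST-ORDER TERM `F_j = C₀^{(j)}E_jC₀^{(j)}` (`C₀^{(j)} = (Δ^{(max j 1)} + aL⁻²Q*Q)⁻¹`):
   `|F_{j+1}(x,y) − F_j(x,y)| ≤ (c_E + √(2ε_Ec_E))·K_mix·L^{−j}·e^{−δ₄₅|x−y|_T}`;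
 * **`kingCovE_mixed_rate`** — the BACKGROUND-DEPENDENT PART of the dressed covariance:
   `|(C_E^{(j)} − C₀^{(j)})(x,y) − (C_E^{(j+1)} − C₀^{(j+1)})(x,y)| ≤ (c_E + √(2ε_Ec_E))·K_mix·L^{−j}·e^{−δ₄₅|x−y|_T}` — the η-rate of the background-dependent part
   VANISHES LINEARLY in the background size, at the rate and decay of (4.38) (`K_mix = kingKmix`, uniform in the torus, the level and the background);
 * **`kingCovE_mixed_limit`** — against part 6c's continuum limits: `|(C_E^{(j)} − C₀^{(j)})(x,y) − (C_E^{(∞)} − C₀^{(∞)})(x,y)| ≤ (c_E + √(2ε_Ec_E))·K_mix·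
   e^{−δ₄₅|x−y|_T}·L^{−j}∕(1 − L⁻¹)`;
 * **`etaRateIneqUnit_kingMixed`** — NE2's typed one-configuration inequality `T4EtaRate.EtaRateIneqUnit` BY NAME for the background-dependent part
   `kingKerMixed = kingKerE − kingKerE(·)(1)` of the dressed unit kernel of part 6b's family `kingInstanceE`, at EVERY `(3.35)∧(3.36)`-regular background of
   size `c₃₅α₀ ≤ c̄`, with constant `B₀ = (c₃₅α₀)·3K_mix` LINEAR IN THE REGULARITY SIZE, decay `δ₄₅`, rate `L⁻¹`, `k` the coarse run's number of scales:
   the part of NE2's unit-layer η-difference that depends on the background is not only uniformly bounded (part 6b) but O(background) — the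
   position-space form of «rate uniform in the coupling ∧ holomorphy in the coupling» of the Spine's resolvent route.

HONEST FRAMING ∕ LIMITS.  As parts 6a–7a: King's `A = 0` SCALAR tower (periodic b.c., flat blocks, `m² > 0`, `L ≥ 2`, levels `k ≥ 1`) DRESSED BY AN
ABSTRACT LOCAL PERTURBATION TOWER; the regularity letters are a READING of the (3.35)∕(3.36) slots as locality ∕ two-spacing bounds of the perturbation —
for Bałaban's `E_k(U) = Δ^{(k)}(U) − Δ^{(k)}(1)` NOT PRINTED (the Spine's (H-bd)∕(H-cons) in position space), asserted by nobody; King prints (4.38) at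
`A = 0` only (p. 670) and no first-order ∕ mixed estimate; NOT Bałaban's `C^{(k)}(Λ; U)`; NOT the carriers of record (NODE 00); NOT a node discharge; typed
28∕28, discharged count untouched; one finite torus programme at fixed ε — NOT ℝ⁴ ∕ infinite volume ∕ OS ∕ mass gap ∕ Clay.  Locators only: [King1986] CMP
**102** (1986) (4.33)–(4.34), (4.38) p. 674, (4.39)–(4.41) p. 675, p. 670; [B9] = [Balaban1985BackgroundPropagators] CMP **99** (1985) (3.35)–(3.36)
p. 396, Thm 3.4 p. 400, Thm 3.15 (3.187) p. 432.
-/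

noncomputable section

open scoped BigOperators Matrix
open Finset Filter Topology

namespace Summit.QuantumFields.YangMills.BalabanUVNodes.N15.KingModel

open Literature.MathematicalPhysics.QuantumFieldTheory.Balaban1983to89
open Literature.MathematicalPhysics.QuantumFieldTheory.Balaban1983to89.B5Prop11Plancherel (Tor fine)
open Literature.MathematicalPhysics.QuantumFieldTheory.Balaban1983to89.T4EtaRate (PairedInstance EtaRateIneqUnit NE2PlusUnit)
open Literature.MathematicalPhysics.QuantumFieldTheory.King1986.Torus (tdistT tdistT_isPseudoDist aminL aminL_pos CDelU CDelU_pos gam0L gam0L_pos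
  kapCT kapCT_pos_le V45 thetaBar delta45 delta45_pos)
open Summit.QuantumFields.BalabanUV.T4Continuum.NE2KingTransplant (IsPseudoMetric UniformCoercive UniformCTBound UniformKernelDecay
  EffectiveOperatorSupRate VolumeSum CovarianceTowerRate)

variable {d : ℕ} {L : ℕ} [NeZero L]

/-! ## §1 The mixed constant -/

/-- THE MIXED CONSTANT `K_mix = ((C_K^E + C_K)·(4∕γ₀) + (4∕γ₀)²)·V²` (`C_K^E = kingCE`, `C_K = kingC`, `γ₀ = gam0L`, `V = V45`). [folklore] -/
def kingKmix (dd : ℕ) (a : ℝ) (L : ℕ) : ℝ :=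
  ((kingCE dd a L + kingC dd a L) * (4 / gam0L dd a L) + (4 / gam0L dd a L) ^ 2) * V45 dd a L ^ 2

section Constants

variable {dd : ℕ} {a : ℝ} {L : ℕ}

/-- `K_mix > 0`. [folklore] -/
theorem kingKmix_pos (ha : 0 < a) (hL : 2 ≤ L) : 0 < kingKmix dd a L := by
  have hγ := gam0L_pos (d := dd) ha hL
  have hV := V45_pos dd ha hL
  have hCE := (kingCE_pos (dd := dd) ha hL).2
  have hC := kingC_nonneg dd a L
  unfold kingKmix
  positivity

/-- `(γ₀ − ρ − ρ_B)⁻¹ ≤ 4∕γ₀` (`ρ + ρ_B ≤ γ₀∕2`). [folklore] -/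
theorem inv_freeMargin_le (ha : 0 < a) (hL : 2 ≤ L) : (gam0L dd a L - (kingRho dd a L + kingRhoB dd a L))⁻¹ ≤ 4 / gam0L dd a L := by
  have hγ := gam0L_pos (d := dd) ha hL
  have hρ := kingRho_add_le (dd := dd) ha hL
  rw [show (4 : ℝ) / gam0L dd a L = (gam0L dd a L / 4)⁻¹ by rw [inv_div]]
  exact inv_anti₀ (by positivity) (by linarith)

/-- `(γ₀ − ρ − ρ_B − 2c_EV)⁻¹ ≤ 4∕γ₀` for `c_E ≤ c̄`. [folklore] -/
theorem inv_dressedMargin_le (ha : 0 < a) (hL : 2 ≤ L) {cE : ℝ} (hcE : cE ≤ kingCbar dd a L) :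
    ((gam0L dd a L - cE * V45 dd a L) - ((kingRho dd a L + cE * V45 dd a L) + kingRhoB dd a L))⁻¹ ≤ 4 / gam0L dd a L := by
  have hγ := gam0L_pos (d := dd) ha hL
  have hm := kingMargin (dd := dd) ha hL hcE
  rw [show (4 : ℝ) / gam0L dd a L = (gam0L dd a L / 4)⁻¹ by rw [inv_div]]
  exact inv_anti₀ (by positivity) hm

/-- THE DOMINATION OF THE SANDWICH CONSTANTS: with `C′ ≤ C_K^E`, `A, A′ ≤ 4∕γ₀`, the three-term constant of `sandwich_rate` is
`≤ (c_E + √(2ε_Ec_E))·K_mix`. [folklore] -/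
theorem sandwichConst_le_kingKmix (ha : 0 < a) (hL : 2 ≤ L) {C' A' A cE εE : ℝ} (hC' : C' ≤ kingCE dd a L)
    (hA' : A' ≤ 4 / gam0L dd a L) (hA0 : 0 ≤ A) (hA : A ≤ 4 / gam0L dd a L) (hcE : 0 ≤ cE) :
    (C' * cE * A + A' * Real.sqrt (2 * (εE * cE)) * A + A' * cE * kingC dd a L) * V45 dd a L ^ 2
      ≤ (cE + Real.sqrt (2 * (εE * cE))) * kingKmix dd a L := by
  have hC := kingC_nonneg dd a L
  have hCE := (kingCE_pos (dd := dd) ha hL).2.le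
  have hs := Real.sqrt_nonneg (2 * (εE * cE))
  have hV2 : 0 ≤ V45 dd a L ^ 2 := sq_nonneg _
  have hg : 0 ≤ 4 / gam0L dd a L := by have := gam0L_pos (d := dd) ha hL; positivity
  have h1 : C' * cE * A ≤ kingCE dd a L * cE * (4 / gam0L dd a L) :=
    mul_le_mul (mul_le_mul_of_nonneg_right hC' hcE) hA hA0 (mul_nonneg hCE hcE)
  have h2 : A' * Real.sqrt (2 * (εE * cE)) * A ≤ 4 / gam0L dd a L * Real.sqrt (2 * (εE * cE)) * (4 / gam0L dd a L) :=
    mul_le_mul (mul_le_mul_of_nonneg_right hA' hs) hA hA0 (mul_nonneg hg hs)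
  have h3 : A' * cE * kingC dd a L ≤ 4 / gam0L dd a L * cE * kingC dd a L :=
    mul_le_mul_of_nonneg_right (mul_le_mul_of_nonneg_right hA' hcE) hC
  calc (C' * cE * A + A' * Real.sqrt (2 * (εE * cE)) * A + A' * cE * kingC dd a L) * V45 dd a L ^ 2
      ≤ (kingCE dd a L * cE * (4 / gam0L dd a L) + 4 / gam0L dd a L * Real.sqrt (2 * (εE * cE)) * (4 / gam0L dd a L)
          + 4 / gam0L dd a L * cE * kingC dd a L) * V45 dd a L ^ 2 := mul_le_mul_of_nonneg_right (add_le_add (add_le_add h1 h2) h3) hV2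
    _ = (cE + Real.sqrt (2 * (εE * cE))) * kingKmix dd a L
          - (cE * (4 / gam0L dd a L) ^ 2 + Real.sqrt (2 * (εE * cE)) * ((kingCE dd a L + kingC dd a L) * (4 / gam0L dd a L)))
            * V45 dd a L ^ 2 := by unfold kingKmix; ring
    _ ≤ (cE + Real.sqrt (2 * (εE * cE))) * kingKmix dd a L :=
        sub_le_self _ (mul_nonneg (add_nonneg (mul_nonneg hcE (sq_nonneg _)) (mul_nonneg hs (mul_nonneg (add_nonneg hCE hC) hg))) hV2)

/-- `C_K ≤ C_K^E` (the free root constant is dominated by the dressed one). [folklore] -/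
theorem kingC_le_kingCE (ha : 0 < a) (hL : 2 ≤ L) : kingC dd a L ≤ kingCE dd a L := by
  have hγ := gam0L_pos (d := dd) ha hL
  have hθ := thetaBar_mul_nonneg (a := a) ha hL
  have hC := CDelU_pos (d := dd) ha (aminL_pos ha hL)
  have hcb := (kingCbar_pos (dd := dd) ha hL).le
  have hA0 : 0 ≤ (gam0L dd a L - (kingRho dd a L + kingRhoB dd a L))⁻¹ :=
    inv_nonneg.mpr (sub_nonneg.mpr (kingRho_add_lt_gam0L (dd := dd) ha hL).le)
  have hA := inv_freeMargin_le (dd := dd) ha hL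
  unfold kingC kingCE kingLip
  rw [mul_assoc (Real.sqrt _)]
  refine mul_le_mul (Real.sqrt_le_sqrt ?_) ?_ (by positivity) (Real.sqrt_nonneg _)
  · nlinarith [mul_nonneg hθ hcb, mul_nonneg hcb hC.le, mul_nonneg hcb hcb]
  · exact mul_le_mul_of_nonneg_right (pow_le_pow_left₀ hA0 hA 2) (sq_nonneg _)

end Constants

/-! ## §2 The first-order term and the background-dependent part of King's dressed covariance: rates by name -/

section DressedMixed

variable {dd : ℕ} {a m2 : ℝ} {L : ℕ} [NeZero L] {M : Fin dd → ℕ} [∀ μ, NeZero (M μ)]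

/-- `√(L⁻²) = L⁻¹`. [folklore] -/
theorem sqrt_inv_sq_L (L : ℕ) : Real.sqrt (((L : ℝ) ^ 2)⁻¹) = (L : ℝ)⁻¹ := by
  rw [Real.sqrt_inv, Real.sqrt_sq (by positivity)]

/-- **η-RATE OF THE FIRST-ORDER BACKGROUND TERM OF KING'S COVARIANCE** (`L ≥ 2`, `a, m² > 0`): for a background `E` local at rate `κ′` with size `c_E ≥ 0`
and two-spacing rate `ε_E·L^{−2j}`, the first-order term `F_j = C₀^{(j)}E_jC₀^{(j)}`, `C₀^{(j)} = (Δ^{(max j 1)} + aL⁻²Q*Q)⁻¹`, obeys at every level and all sites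
`|F_{j+1}(x,y) − F_j(x,y)| ≤ (c_E + √(2ε_Ec_E))·K_mix·(L⁻¹)^j·e^{−δ₄₅|x−y|_T}` (no smallness of the background needed). [cite: King1986, Lemma 4.5 (4.38) p.674, (4.39)–(4.41) p.675 (the mechanism, A = 0)] -/
theorem kingFirstOrder_rate (ha : 0 < a) (hm : 0 < m2) (hL : 2 ≤ L) {E : ℕ → Matrix (Tor (fine L M)) (Tor (fine L M)) ℝ} {cE εE : ℝ}
    (hcE0 : 0 ≤ cE) (hεE0 : 0 ≤ εE) (h335 : UniformKernelDecay E (tdistT (fine L M)) cE (kapCT dd a L))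
    (h336 : EffectiveOperatorSupRate E εE (((L : ℝ) ^ 2)⁻¹)) (j : ℕ) (x y : Tor (fine L M)) :
    |((kingTower a m2 L M (j + 1) + kingBlock a L M)⁻¹ * E (j + 1) * (kingTower a m2 L M (j + 1) + kingBlock a L M)⁻¹
        - (kingTower a m2 L M j + kingBlock a L M)⁻¹ * E j * (kingTower a m2 L M j + kingBlock a L M)⁻¹) x y|
      ≤ (cE + Real.sqrt (2 * (εE * cE))) * kingKmix dd a L * ((L : ℝ)⁻¹) ^ j * Real.exp (-(delta45 dd a L * tdistT (fine L M) x y)) := by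
  have hθ := thetaBar_mul_nonneg (a := a) ha hL
  have h := firstOrder_rate_of_leaves (isPseudoMetric_tdistT (fine L M)) (kingRho_add_lt_gam0L (dd := dd) ha hL) (kapCT_pos_le (d := dd) ha hL).1.le
    hθ (by positivity) hcE0 hεE0 (uniformCoercive_kingTower ha hm hL) (uniformCTBound_kingTower ha hm hL) (uniformKernelDecay_kingTower ha hm hL)
    (effectiveOperatorSupRate_kingTower ha hm hL) (volumeSum_kingTorus ha hL) h335 h336 j x y
  rw [sqrt_inv_sq_L] at h
  refine h.trans ?_
  show _ ≤ _ * Real.exp (-(kapCT dd a L / 2 * tdistT (fine L M) x y))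
  have hA0 : 0 ≤ (gam0L dd a L - (kingRho dd a L + kingRhoB dd a L))⁻¹ :=
    inv_nonneg.mpr (sub_nonneg.mpr (kingRho_add_lt_gam0L (dd := dd) ha hL).le)
  have hA := inv_freeMargin_le (dd := dd) ha hL
  have hK : Real.sqrt (thetaBar a L * a * (2 * CDelU dd a (aminL a L))) * ((gam0L dd a L - (kingRho dd a L + kingRhoB dd a L))⁻¹) ^ 2
      * V45 dd a L ^ 2 = kingC dd a L := rfl
  rw [hK]
  have hdom := sandwichConst_le_kingKmix (dd := dd) (εE := εE) ha hL (kingC_le_kingCE (dd := dd) ha hL) hA hA0 hA hcE0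
  exact mul_le_mul_of_nonneg_right (mul_le_mul_of_nonneg_right hdom (pow_nonneg (inv_nonneg.mpr (Nat.cast_nonneg L)) j)) (Real.exp_pos _).le

/-- **η-RATE OF THE BACKGROUND-DEPENDENT PART OF KING'S DRESSED COVARIANCE — LINEAR IN THE BACKGROUND SIZE** (`L ≥ 2`, `a, m² > 0`): for a background
`E` local at rate `κ′` with size `c_E ≤ c̄` and two-spacing rate `ε_E·L^{−2j}`, `ε_E ≤ c̄`, at every level and all sites
`|(C_E^{(j)} − C₀^{(j)})(x,y) − (C_E^{(j+1)} − C₀^{(j+1)})(x,y)| ≤ (c_E + √(2ε_Ec_E))·K_mix·(L⁻¹)^j·e^{−δ₄₅|x−y|_T}` — the η-rate (4.38) of the DIFFERENCE of the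
dressed and undressed towers vanishes linearly at the trivial background, with the same decay `δ₄₅` and rate `L⁻¹` (part 7a's `mixed_rate_of_leaves` on part 3's
free leaves; constants dominated by `kingMargin`). [cite: King1986, Lemma 4.5 (4.38) p.674, (4.39)–(4.41) p.675 (the mechanism, A = 0); Balaban1985BackgroundPropagators, Thm 3.4 p.400 (background dependence at fixed spacing: the shape being differenced)] -/
theorem kingCovE_mixed_rate (ha : 0 < a) (hm : 0 < m2) (hL : 2 ≤ L) {E : ℕ → Matrix (Tor (fine L M)) (Tor (fine L M)) ℝ} {cE εE : ℝ}
    (hcE0 : 0 ≤ cE) (hcE : cE ≤ kingCbar dd a L) (hεE0 : 0 ≤ εE) (hεE : εE ≤ kingCbar dd a L)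
    (h335 : UniformKernelDecay E (tdistT (fine L M)) cE (kapCT dd a L)) (h336 : EffectiveOperatorSupRate E εE (((L : ℝ) ^ 2)⁻¹)) (j : ℕ)
    (x y : Tor (fine L M)) :
    |(kingCovE a m2 L M E j x y - kingCovE a m2 L M 0 j x y) - (kingCovE a m2 L M E (j + 1) x y - kingCovE a m2 L M 0 (j + 1) x y)|
      ≤ (cE + Real.sqrt (2 * (εE * cE))) * kingKmix dd a L * ((L : ℝ)⁻¹) ^ j * Real.exp (-(delta45 dd a L * tdistT (fine L M) x y)) := by
  have hθ := thetaBar_mul_nonneg (a := a) ha hL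
  have h := mixed_rate_of_leaves (isPseudoMetric_tdistT (fine L M)) (kingGap (dd := dd) ha hL hcE) (kapCT_pos_le (d := dd) ha hL).1.le hθ
    (by positivity) hcE0 hεE0 (uniformCoercive_kingTower ha hm hL) (uniformCTBound_kingTower ha hm hL) (uniformKernelDecay_kingTower ha hm hL)
    (effectiveOperatorSupRate_kingTower ha hm hL) (volumeSum_kingTorus ha hL) h335 h336 j x y
  rw [sqrt_inv_sq_L] at h
  simp only [Matrix.sub_apply] at h
  rw [kingCovE_zero, kingCovE_zero]
  refine le_trans (le_of_eq (by rfl)) (h.trans ?_)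
  show _ ≤ _ * Real.exp (-(kapCT dd a L / 2 * tdistT (fine L M) x y))
  have hA0 : 0 ≤ (gam0L dd a L - (kingRho dd a L + kingRhoB dd a L))⁻¹ :=
    inv_nonneg.mpr (sub_nonneg.mpr (kingRho_add_lt_gam0L (dd := dd) ha hL).le)
  have hA := inv_freeMargin_le (dd := dd) ha hL
  have hA' := inv_dressedMargin_le (dd := dd) ha hL hcE
  have hK : Real.sqrt (thetaBar a L * a * (2 * CDelU dd a (aminL a L))) * ((gam0L dd a L - (kingRho dd a L + kingRhoB dd a L))⁻¹) ^ 2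
      * V45 dd a L ^ 2 = kingC dd a L := rfl
  rw [hK]
  -- the dressed root constant is dominated by `C_K^E` (as in part 6b)
  have hconst : Real.sqrt ((thetaBar a L * a + εE) * (2 * (CDelU dd a (aminL a L) + cE)))
      * (((gam0L dd a L - cE * V45 dd a L) - ((kingRho dd a L + cE * V45 dd a L) + kingRhoB dd a L))⁻¹) ^ 2 * V45 dd a L ^ 2
        ≤ kingCE dd a L := by
    have hC := CDelU_pos (d := dd) ha (aminL_pos ha hL)
    have hcb := (kingCbar_pos (dd := dd) ha hL).le
    unfold kingCE
    rw [mul_assoc]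
    exact mul_le_mul (Real.sqrt_le_sqrt (by gcongr)) (inv_margin_sq_le (dd := dd) ha hL hcE) (by positivity) (Real.sqrt_nonneg _)
  have hdom := sandwichConst_le_kingKmix (dd := dd) (εE := εE) ha hL hconst hA' hA0 hA hcE0
  exact mul_le_mul_of_nonneg_right (mul_le_mul_of_nonneg_right hdom (pow_nonneg (inv_nonneg.mpr (Nat.cast_nonneg L)) j)) (Real.exp_pos _).le

/-- The zero tower carries both letters at size `0`. [folklore] -/
theorem letters_zero (κ r : ℝ) :
    UniformKernelDecay (0 : ℕ → Matrix (Tor (fine L M)) (Tor (fine L M)) ℝ) (tdistT (fine L M)) 0 κ ∧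
      EffectiveOperatorSupRate (0 : ℕ → Matrix (Tor (fine L M)) (Tor (fine L M)) ℝ) 0 r := by
  refine ⟨fun k z w => ?_, fun k z w => ?_⟩
  · rw [Pi.zero_apply, Matrix.zero_apply, abs_zero, zero_mul]
  · rw [Pi.zero_apply, Pi.zero_apply, sub_zero, Matrix.zero_apply, abs_zero, zero_mul]

/-- **THE BACKGROUND-DEPENDENT PART AGAINST ITS CONTINUUM LIMIT** (part 6c's `kingCovLimE`): for a background as in `kingCovE_mixed_rate`, at every level
`|(C_E^{(j)} − C₀^{(j)})(x,y) − (C_E^{(∞)} − C₀^{(∞)})(x,y)| ≤ (c_E + √(2ε_Ec_E))·K_mix·e^{−δ₄₅|x−y|_T}·(L⁻¹)^j∕(1 − L⁻¹)` — the geometric tail of the mixed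
one-step rate, both limits existing by part 6c. [cite: King1986, Lemma 4.5 (4.38) p.674 (its use: the tower is Cauchy)] -/
theorem kingCovE_mixed_limit (ha : 0 < a) (hm : 0 < m2) (hL : 2 ≤ L) {E : ℕ → Matrix (Tor (fine L M)) (Tor (fine L M)) ℝ} {cE εE : ℝ}
    (hcE0 : 0 ≤ cE) (hcE : cE ≤ kingCbar dd a L) (hεE0 : 0 ≤ εE) (hεE : εE ≤ kingCbar dd a L)
    (h335 : UniformKernelDecay E (tdistT (fine L M)) cE (kapCT dd a L)) (h336 : EffectiveOperatorSupRate E εE (((L : ℝ) ^ 2)⁻¹)) (j : ℕ)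
    (x y : Tor (fine L M)) :
    |(kingCovE a m2 L M E j x y - kingCovE a m2 L M 0 j x y) - (kingCovLimE a m2 L M E x y - kingCovLimE a m2 L M 0 x y)|
      ≤ (cE + Real.sqrt (2 * (εE * cE))) * kingKmix dd a L * Real.exp (-(delta45 dd a L * tdistT (fine L M) x y))
          * ((L : ℝ)⁻¹) ^ j / (1 - (L : ℝ)⁻¹) := by
  have hcb := (kingCbar_pos (dd := dd) ha hL).le
  obtain ⟨-, -, -, -, -, hE, -⟩ := kingCovE_tendsto_kingCovLimE (dd := dd) ha hm hL hcE0 hcE hεE0 hεE h335 h336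
  obtain ⟨l0, l0'⟩ := letters_zero (L := L) (M := M) (kapCT dd a L) (((L : ℝ) ^ 2)⁻¹)
  obtain ⟨-, -, -, -, -, h0, -⟩ := kingCovE_tendsto_kingCovLimE (dd := dd) ha hm hL le_rfl hcb le_rfl hcb l0 l0'
  have hlim : Tendsto (fun k => kingCovE a m2 L M E k x y - kingCovE a m2 L M 0 k x y) atTop
      (𝓝 (kingCovLimE a m2 L M E x y - kingCovLimE a m2 L M 0 x y)) := (hE x y).sub (h0 x y)
  have hstep : ∀ k, dist (kingCovE a m2 L M E k x y - kingCovE a m2 L M 0 k x y) (kingCovE a m2 L M E (k + 1) x y - kingCovE a m2 L M 0 (k + 1) x y)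
      ≤ (cE + Real.sqrt (2 * (εE * cE))) * kingKmix dd a L * Real.exp (-(delta45 dd a L * tdistT (fine L M) x y)) * ((L : ℝ)⁻¹) ^ k := fun k => by
    rw [Real.dist_eq]
    refine (kingCovE_mixed_rate (dd := dd) ha hm hL hcE0 hcE hεE0 hεE h335 h336 k x y).trans (le_of_eq ?_)
    ring
  have h := dist_le_of_le_geometric_of_tendsto _ _ (inv_L_nonneg_lt_one hL).2 hstep hlim j
  rwa [Real.dist_eq] at h

end DressedMixed

/-! ## §3 NE2's typed inequality for the background-dependent part of the dressed unit kernel, constant LINEAR in the regularity size -/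

section Socket

variable {a m2 : ℝ}

/-- THE BACKGROUND-DEPENDENT PART OF THE DRESSED UNIT KERNEL of part 6b's family `kingInstanceE`: at index `i` and background `E`,
`(y, y′) ↦ [C_E^{(k+1)} − C_E^{(k)}](y,y′) − [C₀^{(k+1)} − C₀^{(k)}](y,y′)` = `kingKerE` minus its value at the trivial background. [cite: King1986, Lemma 4.5 (4.38) p.674 (the differenced object, A = 0); Balaban1985BackgroundPropagators, Thm 3.15 (3.187) p.432 (C^{(k)}(Λ;U): shape)] -/
def kingKerMixed (a m2 : ℝ) (i : KingIndex d L) : B9.SiteKernel (kingInstanceE a i).gc (kingInstanceE a i).Bf :=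
  ⟨fun E y y' => (kingKerE a m2 i).ker E y y' - (kingKerE a m2 i).ker (kingInstanceE a i).Bf.one y y'⟩

/-- At the trivial background the background-dependent part vanishes. [folklore] -/
theorem kingKerMixed_one (i : KingIndex d L) (y y' : Tor (kingTor i)) : (kingKerMixed a m2 i).ker (kingInstanceE a i).Bf.one y y' = 0 :=
  sub_self _

/-- **NE2's TYPED ONE-CONFIGURATION INEQUALITY `EtaRateIneqUnit` BY NAME FOR THE BACKGROUND-DEPENDENT PART, CONSTANT LINEAR IN THE REGULARITY SIZE**
(torus dimension `d + 1`, `L ≥ 2`, `a, m² > 0`): at every index `i` of the dressed King family (`k ≥ 1` scales) and every `c₃₅, α₀ > 0` with `c₃₅α₀ ≤ c̄`, every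
background `E` that is (3.35)-regular (local at `κ′`, size `c₃₅α₀`) and (3.36)-regular (two-spacing rate `c₃₅α₀·L^{−2j}`) satisfies
`EtaRateIneqUnit (kingKerMixed a m² i) ⊤ |·|_T ((c₃₅α₀)·(3K_mix)) δ₄₅ L⁻¹ k E`, i.e. `|kingKerMixed(E)(y,y′)| ≤ (c₃₅α₀)·3K_mix·e^{−δ₄₅|y−y′|_T}·(L⁻¹)^k`:
the background-dependent part of NE2's unit-layer η-difference is O(regularity size), uniformly in the torus, `k` and the background
(`c_E + √(2ε_Ec_E) ≤ 3c₃₅α₀` at `c_E = ε_E = c₃₅α₀`).  HONEST SCOPE: abstract local perturbation towers dressing King's `A = 0` tower; the letters for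
Bałaban's `Δ^{(k)}(U) − Δ^{(k)}(1)` are NOT PRINTED; count-neutral. [cite: King1986, Lemma 4.5 (4.38) p.674, (4.39)–(4.41) p.675; Balaban1985BackgroundPropagators, (3.35)–(3.36) p.396, Thm 3.15 (3.187) p.432 (quantifier template)] -/
theorem etaRateIneqUnit_kingMixed (ha : 0 < a) (hm : 0 < m2) (hL : 2 ≤ L) (i : KingIndex d L) {c35 α₀ : ℝ} (hc : 0 < c35) (hα : 0 < α₀)
    (hsize : c35 * α₀ ≤ kingCbar (d + 1) a L) (E : (kingInstanceE a i).Bf.Cfg) (h335 : (kingInstanceE a i).Bf.Reg335 c35 α₀ E)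
    (h336 : (kingInstanceE a i).Bf.Reg336 c35 α₀ E) :
    EtaRateIneqUnit (kingKerMixed a m2 i) (fun _ => True) (kingDistE a i) ((c35 * α₀) * (3 * kingKmix (d + 1) a L)) (delta45 (d + 1) a L)
      ((L : ℝ)⁻¹) (kingInstanceE a i).gc.k E := by
  intro y y' _ _
  have hs0 : 0 ≤ c35 * α₀ := (mul_pos hc hα).le
  have hK := (kingKmix_pos (dd := d + 1) ha hL).le
  have h := kingCovE_mixed_rate (dd := d + 1) (M := i.Mn) (m2 := m2) ha hm hL hs0 hsize hs0 hsize h335 h336 i.k y y'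
  have e : (kingKerMixed a m2 i).ker E y y'
      = -((kingCovE a m2 L i.Mn E i.k y y' - kingCovE a m2 L i.Mn 0 i.k y y')
          - (kingCovE a m2 L i.Mn E (i.k + 1) y y' - kingCovE a m2 L i.Mn 0 (i.k + 1) y y')) := by
    show (kingCovE a m2 L i.Mn E (i.k + 1) y y' - kingCovE a m2 L i.Mn E i.k y y')
        - (kingCovE a m2 L i.Mn 0 (i.k + 1) y y' - kingCovE a m2 L i.Mn 0 i.k y y') = _
    ring
  show |(kingKerMixed a m2 i).ker E y y'| ≤ c35 * α₀ * (3 * kingKmix (d + 1) a L) * Real.exp (-(delta45 (d + 1) a L * tdistT (kingTor i) y y'))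
    * ((L : ℝ)⁻¹) ^ i.k
  rw [e, abs_neg]
  refine h.trans ?_
  have hsq : Real.sqrt (2 * (c35 * α₀ * (c35 * α₀))) ≤ 2 * (c35 * α₀) := by
    rw [show 2 * (c35 * α₀ * (c35 * α₀)) = 2 * (c35 * α₀) ^ 2 by ring]
    calc Real.sqrt (2 * (c35 * α₀) ^ 2) ≤ Real.sqrt ((2 * (c35 * α₀)) ^ 2) := Real.sqrt_le_sqrt (by nlinarith [sq_nonneg (c35 * α₀)])
      _ = 2 * (c35 * α₀) := Real.sqrt_sq (by positivity)
  have h3 : c35 * α₀ + Real.sqrt (2 * (c35 * α₀ * (c35 * α₀))) ≤ 3 * (c35 * α₀) := by linarith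
  have hLk : 0 ≤ ((L : ℝ)⁻¹) ^ i.k := pow_nonneg (inv_nonneg.mpr (Nat.cast_nonneg L)) _
  calc (c35 * α₀ + Real.sqrt (2 * (c35 * α₀ * (c35 * α₀)))) * kingKmix (d + 1) a L * ((L : ℝ)⁻¹) ^ i.k
        * Real.exp (-(delta45 (d + 1) a L * tdistT (fine L i.Mn) y y'))
      ≤ 3 * (c35 * α₀) * kingKmix (d + 1) a L * ((L : ℝ)⁻¹) ^ i.k * Real.exp (-(delta45 (d + 1) a L * tdistT (fine L i.Mn) y y')) := by
        gcongr
    _ = c35 * α₀ * (3 * kingKmix (d + 1) a L) * Real.exp (-(delta45 (d + 1) a L * tdistT (kingTor i) y y')) * ((L : ℝ)⁻¹) ^ i.k := by ring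

/-- **PACKAGED OVER THE FAMILY** (the quantifier block of `NE2PlusUnit` with the size-proportional constant displayed): for every `c₃₅ > 0` there is the
window `a₀ = c̄∕c₃₅` such that at EVERY index and every `α₀ > 0` with `Msz·α₀ ≤ a₀`, every (3.35)∧(3.36)-regular background obeys NE2's unit inequality for
the background-dependent part with constant `(c₃₅α₀)·3K_mix` — LINEAR in `α₀` — and the index-uniform `δ₄₅`, `L⁻¹`. [cite: Balaban1985BackgroundPropagators, Thm 3.15 (3.187) p.432 (quantifier template); King1986, Lemma 4.5 (4.38) p.674] -/
theorem etaRateIneqUnit_kingMixed_family (ha : 0 < a) (hm : 0 < m2) (hL : 2 ≤ L) {c35 : ℝ} (hc : 0 < c35) :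
    ∃ δ₀ a₀ K θ : ℝ, 0 < δ₀ ∧ 0 < a₀ ∧ 0 < K ∧ 0 < θ ∧ θ < 1 ∧
      ∀ i : KingIndex d L, ∀ α₀ : ℝ, 0 < α₀ → (kingInstanceE a i).gf.M * α₀ ≤ a₀ →
        ∀ E : (kingInstanceE a i).Bf.Cfg, (kingInstanceE a i).Bf.Reg335 c35 α₀ E → (kingInstanceE a i).Bf.Reg336 c35 α₀ E →
          EtaRateIneqUnit (kingKerMixed a m2 i) (fun _ => True) (kingDistE a i) ((c35 * α₀) * K) δ₀ θ (kingInstanceE a i).gc.k E := by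
  have hcb := kingCbar_pos (dd := d + 1) ha hL
  refine ⟨delta45 (d + 1) a L, kingCbar (d + 1) a L / c35, 3 * kingKmix (d + 1) a L, (L : ℝ)⁻¹, delta45_pos (d := d + 1) ha hL, div_pos hcb hc,
    by have := kingKmix_pos (dd := d + 1) ha hL; positivity, (inv_L_nonneg_lt_one hL).1.lt_of_ne' (by positivity), (inv_L_nonneg_lt_one hL).2,
    fun i α₀ hα hMa E h335 h336 => ?_⟩
  have hsize : c35 * α₀ ≤ kingCbar (d + 1) a L := by
    have h1 : α₀ ≤ i.Msz * α₀ := le_mul_of_one_le_left hα.le i.one_le_Msz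
    have h2 : α₀ ≤ kingCbar (d + 1) a L / c35 := h1.trans hMa
    rwa [le_div_iff₀ hc, mul_comm] at h2
  exact etaRateIneqUnit_kingMixed ha hm hL i hc hα hsize E h335 h336

end Socket

end Summit.QuantumFields.YangMills.BalabanUVNodes.N15.KingModel

end
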